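/-
Origin: expansion seat `prover-pub-hodgecm-mc-binder-2-g20-0`, handover #104 2026-08-21T02:37Z md5 7105a451c190 (NEW; 123 l.; ns HodgeCM.Literature.Theta.LiuAlbaneseModuleDatum (§1) + HodgeCM.Model (§2); §1 generic in the [Liu21] §4.2 datum: biSup_iSup_range_le_block_of_surjective (a family of ℂ[G]-surjections ω(μ, a_y) ↠ M y, y with P y, carries ⨆ (y) (_ : P y), ⨆ ψ : M y →ₗ H, (range ψ)|_ℂ into block μ — iSup₂_le over #101 §1) ∕ mem_biSup_block_of_mem_biSup_iSup_range (membership form, μ ∈ S); §2 at the pinned dictionary of record (#102 liuDictionaryPin) along an Eq of records (#103): **mem_biSup_block_pin_of_line_eq_of_mem_biSup** (line j = p, j ∈ S, ψ : X → p.CharW automorphic on P, φ y : Ω(p, ψ y) ↠ M y ⟹ every tower vector in ⨆ (y) (_ : P y), ⨆ f : M y →ₗ Tower, (range f)|_ℂ lies in ⨆ j' ∈ S, block j' — EXACTLY the shape binder-1's clsU_mem_iSup_block_of_mem_holSat_pin* delivers at X := idèle class characters, P χ := charInv χ ∈ 𝓕, M χ := (D_k.coinvRep χ).asModule, fed by sinst-1's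 dictEquiv* ∕ isAutChar_* and theta-3's exists_line_eq_*), _of_eq_line_ variant, and the singleton form mem_biSup_block_pin_singleton_of_line_eq_of_mem_biSup (S := {j}). PIN-GENERIC (any record p, any datum ∕ modules M, any character family ψ) per lead ROUTING WORD l.15023 (2). CERT lane farm lean-direct (elan 4.32.0, -DautoImplicit=false) over the LANDED₆₉ PKG oleans + binder-2's #103 olean built from the tabled RUN-70 source 458ec0c9a187: rc 0 ∕ 10 s ∕ 0 warn ∕ 0 proof holes (g20/farm/logs/summary.tsv 02:37:24Z); #print axioms 5 ∕ 5 ⊆ {propext, Classical.choice, Quot.sound}, proof-holeAx 0 (g20/farm/logs/ax_blockfamily.log 3e3a754bf77a); FQN: the five names are new (grep over PKG HodgeCM/**: 0 hits). CONSUMER EVIDENCE (scratch, not shipped): g20/probe/SlotOneBlock.lean 13e432c029ec (rc 0 25 s, ax trio 42a705c9f391) and g20/probe/SlotZeroBlock.lean c8b45d27a217 (rc 0 36 s, ax trio cb36740b75c8) COMPOSE binder-1 #R125r2 + sinst-1 #1254∕#1256 + staged #1260∕#1261 + theta-3 staged #S16 r2∕#S18 + #103 + THIS LEAF into the block clause of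 «ATq»∕«ATqR»'s hJ for one saturated form of slots 1∕0 at the default-split pin. NAME LIST (theorems): HodgeCM.Model.mem_biSup_block_pin_of_line_eq_of_mem_biSup · HodgeCM.Model.mem_biSup_block_pin_singleton_of_line_eq_of_mem_biSup · HodgeCM.Literature.Theta.LiuAlbaneseModuleDatum.biSup_iSup_range_le_block_of_surjective. (`HOME/mc/pub-hodgecm-mc-binder-2/g20/stage71/HodgeCM/Model/Binders/JLiuBlockFamily.lean`, md5 7105a451c190, 123 lines);
landed by the gen-30 packager (p-g30) in gate run 71 as `HodgeCM/Model/Binders/JLiuBlockFamily.lean` (verbatim).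
-/
/-
Origin: BINDER seat `prover-pub-hodgecm-mc-binder-2-g20-0` (unit pub-hodgecm-mc-binder-2-g20, gen 20 of mc-binder-2), 2026-08-21.
Target in PKG: `HodgeCM/Model/Binders/JLiuBlockFamily.lean` (NEW additive KERNEL leaf beside E; imports binder-2 #103
`Model/LiuDictionaryPinEq` (RUN 70) and #101 `Model/Binders/JLiuBlockTransport` (RUN 68) only; nothing imports it; outside E's import
closure; MODEL-N ±0).
KERNEL ONLY: theorems; 0 definitions, 0 records, nothing cited, 0 `def … : Prop`. Nothing here is a claim of the manuscripts under
adjudication.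
-/
import Summits.HodgeConjecture.HodgeCM.Model.LiuDictionaryPinEq
import Summits.HodgeConjecture.HodgeCM.Model.Binders.JLiuBlockTransport

set_option autoImplicit false

/-!
# (J3) The pin's block clause from a CHARACTER-INDEXED isotypic sum — the shape binder-1's `hfam` clause 2 delivers

binder-1's `hfam` clause 2 at the pin (#R125r2 `clsU_mem_iSup_block_of_mem_holSat_pinZero ∕ One`, #R127 `…pinTwo ∕ Three`) puts the
tower class of every saturated theta form of slot `k` in the DOUBLE supremum

  `⨆ (χ) (_ : charInv χ ∈ 𝓕), ⨆ ψ : (D_k.coinvRep χ).asModule →ₗ[ℂ[U(V)(𝔸_f)]] Tower, (range ψ)|_ℂ`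

over the automorphic characters `χ` of the slot's weight set, `D_k` the slot's `ThetaDistDatum`; sinst-1's bridges (#1254 `dictEquivOne`,
#1256 `dictEquivZeroCanonical`, …) identify each `(D_k.coinvRep χ).asModule` with the dictionary carrier `Ω(p_k, ψ_k χ)` of ONE record `p_k`
(the slot record, independent of `χ`) at a slot character `ψ_k χ`, automorphic by sinst-1 #1260 ∕ #1261; theta-3's pointed enumeration
(#S16 r2 `LiuIndex.I.exists_line_eq_ofCMOf_of_eq`, #S18) gives ONE index `j_k` with `line j_k = p_k`.  This leaf is the lattice step in
between, ONCE, generic in everything: a double supremum of isotypic sums of modules `M y` (`y` ranging over any type `X` cut by any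
predicate `P`), each a `ℂ[U(V)(𝔸_f)]`-quotient of `Ω(p, ψ y)` for ONE record `p = line j` and automorphic `ψ y`, lies in `⨆ j' ∈ S, block j'`
for every finite `S ∋ j` — so the assembly feeds binder-1's membership, sinst-1's arrows and theta-3's index straight in, with `S := {j_k}`.

* §1 `LiuAlbaneseModuleDatum.biSup_iSup_range_le_block_of_surjective` ∕ `mem_biSup_block_of_mem_biSup_iSup_range` — generic in the
  datum ([Liu21] §4.2 carriers, #101 §1 summed over a family);
* §2 `mem_biSup_block_pin_of_line_eq_of_mem_biSup` — at the pinned dictionary of record (#102) along an `Eq` of records (#103).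
Plumbing only (`iSup₂_le` over #101 ∕ #103); nothing asserted about any instance.
-/

noncomputable section

open Function Set
open NumberField
open Literature.AlgebraicGeometry.Motives
open Literature.AlgebraicGeometry.ShimuraVarieties
open Literature.AlgebraicGeometry.HodgeTheory
open Literature.NumberTheory.Automorphic
open Literature.NumberTheory.Automorphic.PicardCM
open Literature.NumberTheory.Transcendental (Arapura2012_Cor_15_4_6)

/-! ## §1. Generic: a character-indexed family of isotypic sums lands in one block -/

namespace HodgeCM.Literature.Theta.LiuAlbaneseModuleDatum

universe u v

variable {G : Type u} [Group G] {Lvl : Type v} {Kof : Lvl → Subgroup G} (D : LiuAlbaneseModuleDatum G Kof)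
variable {X : Type*} {P : X → Prop} (M : X → Type*) [∀ y, AddCommGroup (M y)] [∀ y, Module (MonoidAlgebra ℂ G) (M y)]

/-- a family of `ℂ[G]`-SURJECTIONS `ω(μ, a_y) ↠ M y` (`y` with `P y`) carries the double supremum of the `ℂ[G]`-images of the `M y` in `H`
into the `μ`-block. [folklore] -/
theorem biSup_iSup_range_le_block_of_surjective (μ : D.Char) (a : ∀ y, P y → D.Adm μ)
    (φ : ∀ (y) (hy : P y), D.Ω μ (a y hy) →ₗ[MonoidAlgebra ℂ G] M y) (hφ : ∀ y hy, Surjective (φ y hy)) :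
    ⨆ (y : X) (_ : P y), ⨆ ψ : M y →ₗ[MonoidAlgebra ℂ G] D.H, (LinearMap.range ψ).restrictScalars ℂ ≤ D.block μ :=
  iSup₂_le fun y hy => D.iSup_range_le_block_of_surjective μ (a y hy) (φ y hy) (hφ y hy)

/-- **membership form over a finite index set**: `x` in the double supremum, `μ ∈ S` ⇒ `x ∈ ⨆ μ ∈ S, block μ`. [folklore] -/
theorem mem_biSup_block_of_mem_biSup_iSup_range {S : Finset D.Char} {μ : D.Char} (hμ : μ ∈ S) (a : ∀ y, P y → D.Adm μ)
    (φ : ∀ (y) (hy : P y), D.Ω μ (a y hy) →ₗ[MonoidAlgebra ℂ G] M y) (hφ : ∀ y hy, Surjective (φ y hy)) {x : D.H}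
    (hx : x ∈ ⨆ (y : X) (_ : P y), ⨆ ψ : M y →ₗ[MonoidAlgebra ℂ G] D.H, (LinearMap.range ψ).restrictScalars ℂ) :
    x ∈ ⨆ μ ∈ S, D.block μ :=
  (le_iSup₂ (f := fun μ (_ : μ ∈ S) => D.block μ) μ hμ) (D.biSup_iSup_range_le_block_of_surjective M μ a φ hφ hx)

end HodgeCM.Literature.Theta.LiuAlbaneseModuleDatum

/-! ## §2. At the pinned dictionary of record, along an equality of index records -/

namespace HodgeCM.Model

open HodgeCM.Model.TowerLevel HodgeCM.Model.TowerCarrier HodgeCM.Literature.Theta HodgeCM.Literature.Theta.LiuAlbaneseModuleDatum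
open HodgeCM.Universe (ThetaModel)

variable (hHD : exists_isReal_hodgeModel) (hI : hodgePQ_independent_of_hodgeModel)
  (h₁ : BallQuotientUniformised) (h₃ : CMAbelianVarietyRealised) (hA : Arapura2012_Cor_15_4_6)
variable {L : CMField} {ι₁ : (L : Type) →+* ℂ} (V : HermSpace3 L ι₁) (I : Type) (line : I → SplitLineE V)
variable {X : Type*} {P : X → Prop} (M : X → Type*) [∀ y, AddCommGroup (M y)] [∀ y, Module (adelicAlgebra V) (M y)]

/-- **THE `hJS` BLOCK CLAUSE AT THE PIN FROM A CHARACTER-INDEXED ISOTYPIC SUM, ALONG AN EQUALITY OF INDEX RECORDS**: if the index line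
`line j` (`j ∈ S`) is propositionally EQUAL to a record `p`, and every module `M y` (`y` with `P y`) is a `ℂ[U(V)(𝔸_f)]`-quotient of
`Ω(p, ψ y)` for a character `ψ y` automorphic on `p`, then every tower vector in `⨆ (y) (_ : P y), ⨆ f : M y →ₗ Tower, (range f)|_ℂ` lies in
`⨆ j' ∈ S, block j'` of the pinned dictionary.  (The assembly's instance: `X` the idèle class characters, `P χ := charInv χ ∈ 𝓕`,
`M χ := (D_k.coinvRep χ).asModule`, `p` the slot record, `ψ` sinst-1's slot character, `x := clsU F`, `S := {j_k}`.) [folklore] -/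
theorem mem_biSup_block_pin_of_line_eq_of_mem_biSup {S : Finset I} {j : I} (hj : j ∈ S) {p : SplitLineE V} (hp : line j = p)
    (ψ : X → p.CharW) (hψ : ∀ y, P y → p.IsAutChar (ψ y))
    (φ : ∀ (y) (_ : P y), p.Ω (ιVE V) (ψ y) →ₗ[adelicAlgebra V] M y) (hφ : ∀ y hy, Surjective (φ y hy))
    {x : Tower hHD hI (ballQuotientUniformisedDatum_of h₁) h₃ hA V}
    (hx : x ∈ ⨆ (y : X) (_ : P y), ⨆ f : M y →ₗ[adelicAlgebra V] Tower hHD hI (ballQuotientUniformisedDatum_of h₁) h₃ hA V,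
      (LinearMap.range f).restrictScalars ℂ) :
    (x : (liuDictionaryPin hHD hI h₁ h₃ hA V I line).H) ∈ ⨆ j' ∈ S, (liuDictionaryPin hHD hI h₁ h₃ hA V I line).block j' := by
  subst hp
  exact (liuDictionaryPin hHD hI h₁ h₃ hA V I line).mem_biSup_block_of_mem_biSup_iSup_range M hj
    (fun y hy => ⟨ψ y, hψ y hy⟩) φ hφ hx

/-- the same with the equality the other way round. [folklore] -/
theorem mem_biSup_block_pin_of_eq_line_of_mem_biSup {S : Finset I} {j : I} (hj : j ∈ S) {p : SplitLineE V} (hp : p = line j)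
    (ψ : X → p.CharW) (hψ : ∀ y, P y → p.IsAutChar (ψ y))
    (φ : ∀ (y) (_ : P y), p.Ω (ιVE V) (ψ y) →ₗ[adelicAlgebra V] M y) (hφ : ∀ y hy, Surjective (φ y hy))
    {x : Tower hHD hI (ballQuotientUniformisedDatum_of h₁) h₃ hA V}
    (hx : x ∈ ⨆ (y : X) (_ : P y), ⨆ f : M y →ₗ[adelicAlgebra V] Tower hHD hI (ballQuotientUniformisedDatum_of h₁) h₃ hA V,
      (LinearMap.range f).restrictScalars ℂ) :
    (x : (liuDictionaryPin hHD hI h₁ h₃ hA V I line).H) ∈ ⨆ j' ∈ S, (liuDictionaryPin hHD hI h₁ h₃ hA V I line).block j' :=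
  mem_biSup_block_pin_of_line_eq_of_mem_biSup hHD hI h₁ h₃ hA V I line M hj hp.symm ψ hψ φ hφ hx

/-- **singleton form** (`S := {j}`), the shape of one slot: the conclusion reads `∈ ⨆ j' ∈ ({j} : Finset I), block j'`. [folklore] -/
theorem mem_biSup_block_pin_singleton_of_line_eq_of_mem_biSup {j : I} {p : SplitLineE V} (hp : line j = p)
    (ψ : X → p.CharW) (hψ : ∀ y, P y → p.IsAutChar (ψ y))
    (φ : ∀ (y) (_ : P y), p.Ω (ιVE V) (ψ y) →ₗ[adelicAlgebra V] M y) (hφ : ∀ y hy, Surjective (φ y hy))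
    {x : Tower hHD hI (ballQuotientUniformisedDatum_of h₁) h₃ hA V}
    (hx : x ∈ ⨆ (y : X) (_ : P y), ⨆ f : M y →ₗ[adelicAlgebra V] Tower hHD hI (ballQuotientUniformisedDatum_of h₁) h₃ hA V,
      (LinearMap.range f).restrictScalars ℂ) :
    (x : (liuDictionaryPin hHD hI h₁ h₃ hA V I line).H) ∈
      ⨆ j' ∈ ({j} : Finset I), (liuDictionaryPin hHD hI h₁ h₃ hA V I line).block j' :=
  mem_biSup_block_pin_of_line_eq_of_mem_biSup hHD hI h₁ h₃ hA V I line M (Finset.mem_singleton_self j) hp ψ hψ φ hφ hx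

end HodgeCM.Model

end
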